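import Summits.QuantumFields.BalabanUV.T4Continuum.Spine.NE2.CovariantTableBalabanTwoLevel
import Summits.QuantumFields.BalabanUV.T4Continuum.Support.LineAveragingTwoLevel

/-!
# T⁴ programme, spine node NE2 (U1a) — R14 W2‴: THE COMPOSITION IDENTITY — `Q_{k+1}(T_Bal) = Q_k(T_Bal) · Q₁(W_{k+1})` as a KERNEL IDENTITY of matrices
# (cell `pub-balaban-gaps`, seat ne2 gen 4; plan `run/shared/lean/pub/pub-balaban-gaps/ne/NE2-R14-PLAN.md` STATUS v4)

`CovariantTableBalaban.TBal` was DESIGNED so that `QcovT (lev L k) M (TBal W k)` represents print's composition [B9] (3.15) `Q_k(U) = Q(Ū^{(k−1)})⋯Q(U)` of one-step covariant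
averagings [B7] (125); only the flat case (`QcovT_TBal_one`) was a theorem.  THIS FILE makes the composition a kernel identity:
 * **`Qstep n L M S`** — the ONE-STEP COVARIANT AVERAGING between adjacent levels `n → L·n` as a rectangular matrix, for a one-step transporter table `S` indexed by the coarse point:
   `(Q₁(S)A)_μ(x) = L^{−(d+1)} Σ_{r∈[0,L)^d} Σ_{s<L} S(x, r, μ, s)·A_μ(L·x + r + s e_μ)` ([B7] (125)'s shape: block sum over `B(x)`, then the line);
 * **`QcovT_mul_Qstep`** — for tables with `T′(y, L·j + r, μ, L·t + s) = T(y, j, μ, t)·S(n·y + j + t e_μ, r, μ, s)`: `QcovT (L n) M T′ = QcovT n M T · Qstep n L M S` (re-indexing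
   `j′ = L·j + r` (`sum_glue`), `t′ = L·t + s` (`sum_line_split`), and the point identity `(Ln)·y + (L·j + r) + (Lt + s)e_μ = L·(n·y + j + t e_μ) + r + s e_μ` (row B3's `bpt_glue`, `cpt_add_tstep` BY NAME));
 * **`stepTable`**, **`TBal_glue_line`** (`TBal W (k+1) y (L·j+r) μ (L·t+s) = TBal W k y j μ t · stepTable W (k+1) (n·y + j + t e_μ) r μ s`, from file 3's `TBal_succ` and the base-point
   identity `lpt_succ_eq_cpt`), and **`QcovT_TBal_succ`**: `QcovT (lev L (k+1)) M (TBal W (k+1)) = QcovT (lev L k) M (TBal W k) · Qstep (lev L k) L M (stepTable W (k+1))` — so, by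
   induction from `TBal W 0 ≡ 1`, `Q_k(T_Bal) = Q₀ ⊗ 1 · Q₁(W_1) ⋯ Q₁(W_k)`: the table averaging of `TBal` IS the composition of the one-step covariant averagings of the data fields.
HONEST FRAMING (T4-DAG p. 1).  An algebraic identity between TYPED operators on the tree's finite tori; `W` DATA ((15)'s `Ū` untyped, F6 (ζ)); the one-step operator is (125)'s MAIN
TERM shape (the (124) remainder is file 6's displayed datum); NOT NE2, NOT [B9] (3.15) as printed about Bałaban's minimiser; NE2 (U1a) NOT PROVED; spine PROVED 0/9 unchanged; NOT
continuum YM / infinite volume / mass gap / Clay.  HONEST DEPENDENCY: continuum YM on T⁴ ⇐ BetaPertH ∧ nine spine estimates (0/9 proved); BetaPertH ⇐ (D1) ∧ (D4) ∧ CAP+tail;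
G-an2-4 gates asym, D1 and NE2/3/4.  No `sorry`.
-/

noncomputable section

open scoped BigOperators ComplexConjugate Matrix Matrix.Norms.L2Operator Kronecker
open Finset

namespace Summit.QuantumFields.BalabanUV.T4Continuum.NE2.ComposedAveragingIdentity

open Literature.MathematicalPhysics.QuantumFieldTheory.Balaban1983to89.B5Prop11Plancherel (Tor fine unitVec)
open Literature.MathematicalPhysics.QuantumFieldTheory.Balaban1983to89.B5Block118 (QvOp bpt tstep up iota)
open Literature.MathematicalPhysics.QuantumFieldTheory.Balaban1983to89.B5Blocks16 (bpt_val bpt_eq_natCast)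
open Literature.MathematicalPhysics.QuantumFieldTheory.Balaban1983to89.B5Composition116 (tstep_add)
open Literature.MathematicalPhysics.QuantumFieldTheory.Balaban1983to89.B5G183RateTorus (cpt)
open Literature.MathematicalPhysics.QuantumFieldTheory.Balaban1983to89.B5G183RateTorusW (off)
open Literature.MathematicalPhysics.QuantumFieldTheory.Balaban1983to89.B5G183RateUnitTower (lev lev_neZero)
open Summit.QuantumFields.BalabanUV.T4Continuum
open Summit.QuantumFields.BalabanUV.T4Continuum.BalabanAveragedTowerUnit (idx)
open Summit.QuantumFields.BalabanUV.T4Continuum.BalabanAveragedTowerModes (val_cpt_add_off)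
open Summit.QuantumFields.BalabanUV.T4Continuum.CovariantBlockAveraging (transport)
open Summit.QuantumFields.BalabanUV.T4Continuum.LineAveragingPairing (glue glue_val sum_glue)
open Summit.QuantumFields.BalabanUV.T4Continuum.LineAveragingTwoLevel (bpt_glue cpt_add_tstep)
open Summit.QuantumFields.BalabanUV.T4Continuum.NE2.CovariantTableAveraging (Table QcovT)
open Summit.QuantumFields.BalabanUV.T4Continuum.NE2.CovariantTableBalaban (lpt contourFrom digit coordAt stepT TBal)
open Summit.QuantumFields.BalabanUV.T4Continuum.NE2.CovariantTableBalabanTwoLevel (TBal_succ mul_add_div_pow_succ digit_zero_glue)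

variable {d : ℕ}

/-! ## §1 Re-indexing the line position `t′ = L·t + s` and the point identities -/

/-- `Σ_{t′<L·n} g(t′) = Σ_{t<n} Σ_{s<L} g(L·t + s)`. [folklore] -/
theorem sum_range_line_split {β : Type*} [AddCommMonoid β] (L n : ℕ) (g : ℕ → β) :
    ∑ t' ∈ range (L * n), g t' = ∑ t ∈ range n, ∑ s ∈ range L, g (L * t + s) := by
  induction n with
  | zero => simp
  | succ n ih => rw [Nat.mul_succ, Finset.sum_range_add, ih, Finset.sum_range_succ]

/-- the same over `Fin`: `Σ_{t′ : Fin (L·n)} g t′ = Σ_{t : Fin n} Σ_{s : Fin L} g(L·t + s)`. [folklore] -/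
theorem sum_line_split {β : Type*} [AddCommMonoid β] (L n : ℕ) (g : ℕ → β) :
    ∑ t' : Fin (L * n), g (t' : ℕ) = ∑ t : Fin n, ∑ s : Fin L, g (L * (t : ℕ) + (s : ℕ)) := by
  rw [Fin.sum_univ_eq_sum_range (fun t' => g t') (L * n), sum_range_line_split,
    Fin.sum_univ_eq_sum_range (fun t => ∑ s : Fin L, g (L * t + (s : ℕ))) n]
  exact Finset.sum_congr rfl fun t _ => (Fin.sum_univ_eq_sum_range (fun s => g (L * t + s)) L).symm

section Points

variable (n L : ℕ) [NeZero n] [NeZero L] (M : Fin d → ℕ) [hM : ∀ μ, NeZero (M μ)]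

/-- the block-scaling map in `Nat`-cast form: `up n M y ν = ↑(n·v(y_ν))`. [folklore] -/
theorem up_eq_natCast (y : Tor M) (ν : Fin d) : up n M y ν = ((n * (y ν).val : ℕ) : ZMod (fine n M ν)) := by
  have h := bpt_eq_natCast n M y (fun _ => (0 : Fin n)) ν
  have h0 : bpt n M y (fun _ => (0 : Fin n)) ν = up n M y ν := by
    show up n M y ν + iota n M (fun _ => (0 : Fin n)) ν = up n M y ν
    simp [iota]
  rw [← h0, h]; simp

/-- **THE FINEST STEP's BASE POINT IS THE CORNER OF THE COMPOSITIONAL PARENT's BLOCK**: `lpt (k+1) y (L·(j + t e_μ)) = cpt (n·y + j + t e_μ)`, `n = L^k`. [folklore] -/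
theorem lpt_succ_eq_cpt (k : ℕ) (y : Tor M) (j : Fin d → Fin (lev L k)) (μ : Fin d) (t : ℕ) :
    lpt L M (k + 1) y (fun ν => L * ((j ν : ℕ) + if ν = μ then t else 0))
      = cpt (lev L k) L M (bpt (lev L k) M y j + tstep (fine (lev L k) M) μ t) := by
  haveI := lev_neZero L (k + 1)
  haveI := lev_neZero L k
  funext ν
  have hfine : fine (L * lev L k) M ν = L * fine (lev L k) M ν := by simp only [fine]; ring
  have hlev : lev L (k + 1) = L * lev L k := rfl
  show up (lev L (k + 1)) M y ν + (((L * ((j ν : ℕ) + if ν = μ then t else 0)) : ℕ) : ZMod (fine (lev L (k + 1)) M ν))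
    = (((L * ((bpt (lev L k) M y j + tstep (fine (lev L k) M) μ t) ν).val) : ℕ) : ZMod (fine (L * lev L k) M ν))
  rw [up_eq_natCast, ← Nat.cast_add]
  refine (ZMod.natCast_eq_natCast_iff' _ _ (fine (L * lev L k) M ν)).mpr ?_
  rw [hfine, Nat.mul_mod_mul_left, Pi.add_apply, ZMod.val_add, bpt_val]
  by_cases hν : ν = μ
  · subst hν
    simp only [tstep, if_true, ZMod.val_natCast]
    rw [hlev, show L * lev L k * (y ν).val + L * ((j ν : ℕ) + t) = L * (lev L k * (y ν).val + (j ν : ℕ) + t) by ring, Nat.mul_mod_mul_left,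
      Nat.mod_mod, Nat.add_mod_mod]
  · simp only [tstep, if_neg hν, add_zero, ZMod.val_zero]
    rw [hlev, show L * lev L k * (y ν).val + L * (j ν : ℕ) = L * (lev L k * (y ν).val + (j ν : ℕ)) by ring, Nat.mul_mod_mul_left, Nat.mod_mod]

end Points

/-! ## §2 The one-step covariant averaging between adjacent levels and the composition identity for tables -/

section Step

variable (n L : ℕ) [NeZero n] [NeZero L] (M : Fin d → ℕ) [hM : ∀ μ, NeZero (M μ)] {o : Type*} [Fintype o] [DecidableEq o]

/-- **THE ONE-STEP COVARIANT AVERAGING `Q₁(S)` BETWEEN ADJACENT LEVELS** `n → L·n` with a one-step transporter table `S` indexed by the COARSE point: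
`(Q₁(S)A)_μ(x) = L^{−(d+1)} Σ_{r∈[0,L)^d} Σ_{s<L} S(x,r,μ,s)·A_μ(L·x + r + s e_μ)`. [cite: Balaban1985Averaging, (125) p.36 (shape)] [folklore] -/
def Qstep (S : Tor (fine n M) → (Fin d → Fin L) → Fin d → ℕ → Matrix o o ℂ) :
    Matrix ((Tor (fine n M) × Fin d) × o) ((Tor (fine (L * n) M) × Fin d) × o) ℂ :=
  fun b i => if i.1.2 = b.1.2 then
      ∑ r : Fin d → Fin L, ∑ s : Fin L,
        (if i.1.1 = cpt n L M b.1.1 + off n L M r + tstep (fine (L * n) M) b.1.2 s then (1 / (L : ℂ) ^ (d + 1)) * S b.1.1 r b.1.2 s b.2 i.2 else 0)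
    else 0

omit [NeZero n] in
/-- the refined point of the composition: `(Ln)·y + (L·j + r) + (Lt + s) e_μ = L·(n·y + j + t e_μ) + r + s e_μ`. [folklore] -/
theorem bpt_glue_add_tstep (y : Tor M) (j : Fin d → Fin n) (r : Fin d → Fin L) (μ : Fin d) (t s : ℕ) :
    bpt (L * n) M y (glue n L (j, r)) + tstep (fine (L * n) M) μ (L * t + s)
      = cpt n L M (bpt n M y j + tstep (fine n M) μ t) + off n L M r + tstep (fine (L * n) M) μ s := by
  haveI : NeZero n := ⟨fun h => by subst h; exact absurd (j μ).isLt (by simp)⟩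
  rw [bpt_glue, cpt_add_tstep, tstep_add]
  abel

omit [DecidableEq o] in
/-- **THE COMPOSITION IDENTITY FOR TABLES**: if the fine table factorises through the coarse table and a one-step table along the compositional parent,
`T′(y, L·j + r, μ, L·t + s) = T(y, j, μ, t)·S(n·y + j + t e_μ, r, μ, s)` (`t < n`, `s < L`), then `Q_{Ln}(T′) = Q_n(T) · Q₁(S)`. [cite: Balaban1985BackgroundPropagators, (3.15) p.393 (shape)] [folklore] -/
theorem QcovT_mul_Qstep (T' : Table d (L * n) M o) (T : Table d n M o) (S : Tor (fine n M) → (Fin d → Fin L) → Fin d → ℕ → Matrix o o ℂ)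
    (hT : ∀ (y : Tor M) (j : Fin d → Fin n) (r : Fin d → Fin L) (μ : Fin d) (t : Fin n) (s : Fin L),
      T' y (glue n L (j, r)) μ (L * (t : ℕ) + (s : ℕ)) = T y j μ t * S (bpt n M y j + tstep (fine n M) μ t) r μ s) :
    QcovT (L * n) M T' = QcovT n M T * Qstep n L M S := by
  ext ⟨⟨y, μ⟩, α⟩ ⟨⟨x', μ'⟩, α'⟩
  rw [Matrix.mul_apply]
  by_cases hμ : μ' = μ
  · subst hμ
    set c' : ℂ := 1 / (((L * n : ℕ) : ℂ)) ^ (d + 1) with hc'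
    set cn : ℂ := 1 / (n : ℂ) ^ (d + 1) with hcn
    set cL : ℂ := 1 / (L : ℂ) ^ (d + 1) with hcL
    have hcc : c' = cn * cL := by rw [hc', hcn, hcL]; push_cast; rw [mul_pow]; field_simp
    -- canonical form `Σ_j Σ_t Σ_r Σ_s Σ_α″ F`
    set F : (Fin d → Fin n) → Fin n → (Fin d → Fin L) → Fin L → o → ℂ := fun j t r s α'' =>
      if x' = cpt n L M (bpt n M y j + tstep (fine n M) μ' t) + off n L M r + tstep (fine (L * n) M) μ' s then
        cn * T y j μ' t α α'' * (cL * S (bpt n M y j + tstep (fine n M) μ' t) r μ' s α'' α') else 0 with hF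
    -- the left-hand side in canonical form
    have hL : QcovT (L * n) M T' ((y, μ'), α) ((x', μ'), α')
        = ∑ j : Fin d → Fin n, ∑ t : Fin n, ∑ r : Fin d → Fin L, ∑ s : Fin L, ∑ α'' : o, F j t r s α'' := by
      simp only [QcovT, if_true]
      rw [sum_glue]
      refine Finset.sum_congr rfl fun j _ => ?_
      have hsplit : ∀ r : Fin d → Fin L,
          (∑ t' : Fin (L * n), (if x' = bpt (L * n) M y (glue n L (j, r)) + tstep (fine (L * n) M) μ' (t' : ℕ) then
              c' * T' y (glue n L (j, r)) μ' (t' : ℕ) α α' else 0))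
          = ∑ t : Fin n, ∑ s : Fin L, (if x' = bpt (L * n) M y (glue n L (j, r)) + tstep (fine (L * n) M) μ' (L * (t : ℕ) + (s : ℕ)) then
              c' * T' y (glue n L (j, r)) μ' (L * (t : ℕ) + (s : ℕ)) α α' else 0) :=
        fun r => sum_line_split L n (fun t' => if x' = bpt (L * n) M y (glue n L (j, r)) + tstep (fine (L * n) M) μ' t' then
          c' * T' y (glue n L (j, r)) μ' t' α α' else 0)
      refine (Finset.sum_congr rfl (fun r (_ : r ∈ (Finset.univ : Finset (Fin d → Fin L))) => hsplit r)).trans ?_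
      refine Finset.sum_comm.trans ?_
      refine Finset.sum_congr rfl fun t _ => ?_
      refine Finset.sum_congr rfl fun r _ => ?_
      refine Finset.sum_congr rfl fun s _ => ?_
      rw [bpt_glue_add_tstep, hT y j r μ' t s]
      by_cases h : x' = cpt n L M (bpt n M y j + tstep (fine n M) μ' t) + off n L M r + tstep (fine (L * n) M) μ' s
      · have hF1 : ∀ α'' : o, F j t r s α'' = cn * T y j μ' t α α'' * (cL * S (bpt n M y j + tstep (fine n M) μ' t) r μ' s α'' α') := by
          intro α''; rw [hF]; exact if_pos h
        rw [if_pos h, Finset.sum_congr rfl (fun α'' (_ : α'' ∈ (Finset.univ : Finset o)) => hF1 α''), Matrix.mul_apply, Finset.mul_sum]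
        refine Finset.sum_congr rfl fun α'' _ => ?_
        rw [hcc]; ring
      · have hF0 : ∀ α'' : o, F j t r s α'' = 0 := by intro α''; rw [hF]; exact if_neg h
        rw [if_neg h, Finset.sum_congr rfl (fun α'' (_ : α'' ∈ (Finset.univ : Finset o)) => hF0 α''), Finset.sum_const_zero]
    -- the right-hand side in canonical form
    have hR : ∑ c : (Tor (fine n M) × Fin d) × o, QcovT n M T ((y, μ'), α) c * Qstep n L M S c ((x', μ'), α')
        = ∑ j : Fin d → Fin n, ∑ t : Fin n, ∑ r : Fin d → Fin L, ∑ s : Fin L, ∑ α'' : o, F j t r s α'' := by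
      -- only the colour slot `μ′` of the intermediate level contributes
      have h1 : ∑ c : (Tor (fine n M) × Fin d) × o, QcovT n M T ((y, μ'), α) c * Qstep n L M S c ((x', μ'), α')
          = ∑ α'' : o, ∑ x : Tor (fine n M), QcovT n M T ((y, μ'), α) ((x, μ'), α'') * Qstep n L M S ((x, μ'), α'') ((x', μ'), α') := by
        rw [Fintype.sum_prod_type, Fintype.sum_prod_type, Finset.sum_comm, Finset.sum_eq_single μ']
        · exact Finset.sum_comm
        · intro ν _ hν
          refine Finset.sum_eq_zero fun x _ => Finset.sum_eq_zero fun α'' _ => ?_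
          have : QcovT n M T ((y, μ'), α) ((x, ν), α'') = 0 := by simp only [QcovT, if_neg hν]
          rw [this, zero_mul]
        · intro h; exact absurd (Finset.mem_univ _) h
      rw [h1]
      -- expand the two factors and collapse the intermediate point
      have h2 : ∀ α'' : o, ∑ x : Tor (fine n M), QcovT n M T ((y, μ'), α) ((x, μ'), α'') * Qstep n L M S ((x, μ'), α'') ((x', μ'), α')
          = ∑ j : Fin d → Fin n, ∑ t : Fin n, ∑ r : Fin d → Fin L, ∑ s : Fin L, F j t r s α'' := by
        intro α''
        have hQ : ∀ x : Tor (fine n M), QcovT n M T ((y, μ'), α) ((x, μ'), α'')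
            = ∑ j : Fin d → Fin n, ∑ t : Fin n, (if x = bpt n M y j + tstep (fine n M) μ' t then cn * T y j μ' t α α'' else 0) := by
          intro x; simp only [QcovT, if_true, hcn]
        have hP : ∀ x : Tor (fine n M), Qstep n L M S ((x, μ'), α'') ((x', μ'), α')
            = ∑ r : Fin d → Fin L, ∑ s : Fin L, (if x' = cpt n L M x + off n L M r + tstep (fine (L * n) M) μ' s then
                cL * S x r μ' s α'' α' else 0) := by
          intro x; simp only [Qstep, if_true, hcL]
        simp_rw [hQ, Finset.sum_mul]
        rw [Finset.sum_comm]
        refine Finset.sum_congr rfl fun j _ => ?_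
        rw [Finset.sum_comm]
        refine Finset.sum_congr rfl fun t _ => ?_
        simp only [ite_mul, zero_mul, Finset.sum_ite_eq', Finset.mem_univ, if_true]
        rw [hP, Finset.mul_sum]
        refine Finset.sum_congr rfl fun r _ => ?_
        rw [Finset.mul_sum]
        refine Finset.sum_congr rfl fun s _ => ?_
        rw [hF]; simp only [mul_ite, mul_zero]
      simp_rw [h2]
      -- sink `α″` innermost
      rw [Finset.sum_comm]; refine Finset.sum_congr rfl fun j _ => ?_
      rw [Finset.sum_comm]; refine Finset.sum_congr rfl fun t _ => ?_
      rw [Finset.sum_comm]; refine Finset.sum_congr rfl fun r _ => ?_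
      rw [Finset.sum_comm]
    rw [hL, hR]
  · -- different colour slots: both sides vanish
    have hl : QcovT (L * n) M T' ((y, μ), α) ((x', μ'), α') = 0 := by simp only [QcovT, if_neg hμ]
    rw [hl]
    symm
    refine Finset.sum_eq_zero fun c _ => ?_
    rcases c with ⟨⟨x, ν⟩, α''⟩
    by_cases hν : ν = μ
    · subst hν
      have : Qstep n L M S ((x, ν), α'') ((x', μ'), α') = 0 := by simp only [Qstep, if_neg hμ]
      rw [this, mul_zero]
    · have : QcovT n M T ((y, μ), α) ((x, ν), α'') = 0 := by simp only [QcovT, if_neg hν]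
      rw [this, zero_mul]

end Step

/-! ## §3 The instance: Bałaban's composed table -/

section Balaban

variable (L : ℕ) [NeZero L] (M : Fin d → ℕ) [hM : ∀ μ, NeZero (M μ)] {o : Type*} [Fintype o] [DecidableEq o]

/-- the ONE-STEP TABLE of the data field `W (k+1)` at level `k+1`: transport along [B7] (9)'s contour from the corner `L·x` by `r`, then `s` steps along `μ`. [folklore] -/
def stepTable (W : (i : ℕ) → Fin d → (idx L M i → Matrix o o ℂ)) (k : ℕ) (x : Tor (fine (lev L k) M)) (r : Fin d → Fin L) (μ : Fin d) (s : ℕ) :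
    Matrix o o ℂ :=
  haveI := lev_neZero L k
  transport (fine (L * lev L k) M) (W (k + 1)) μ (contourFrom M (L * lev L k) (cpt (lev L k) L M x) (fun ν => (r ν : ℕ)) μ s)

/-- **THE FINEST STEP OF THE COMPOSED TABLE IS THE ONE-STEP TABLE AT THE COMPOSITIONAL PARENT**:
`TBal W (k+1) y (L·j + r) μ (L·t + s) = TBal W k y j μ t · stepTable W k (n·y + j + t e_μ) r μ s` (`t < L^k`, `s < L`). [folklore] -/
theorem TBal_glue_line (W : (i : ℕ) → Fin d → (idx L M i → Matrix o o ℂ)) (k : ℕ) (y : Tor M) (j : Fin d → Fin (lev L k)) (r : Fin d → Fin L)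
    (μ : Fin d) (t : Fin (lev L k)) (s : Fin L) :
    TBal L M W (k + 1) y (glue (lev L k) L (j, r)) μ (L * (t : ℕ) + (s : ℕ))
      = TBal L M W k y j μ t * stepTable L M W k (bpt (lev L k) M y j + tstep (fine (lev L k) M) μ t) r μ s := by
  haveI := lev_neZero L k
  have hL : 0 < L := Nat.pos_of_ne_zero (NeZero.ne L)
  have hdiv : (L * (t : ℕ) + (s : ℕ)) / L = (t : ℕ) := by rw [Nat.mul_add_div hL, Nat.div_eq_of_lt s.isLt, add_zero]
  rw [TBal_succ, hdiv]
  congr 1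
  -- the finest step: base point, digits
  have hcoord : (fun ν => L * coordAt L (k + 1) (k + 1 - 1) (fun ν => L * (j ν : ℕ) + (r ν : ℕ)) μ (L * (t : ℕ) + (s : ℕ)) ν)
      = fun ν => L * ((j ν : ℕ) + if ν = μ then (t : ℕ) else 0) := by
    funext ν
    have h1 : k + 1 - (k + 1 - 1) = 1 := by omega
    simp only [coordAt, h1, pow_one, Nat.mul_add_div hL, Nat.div_eq_of_lt (r ν).isLt, Nat.div_eq_of_lt s.isLt, add_zero]
  have hdr : (fun ν => digit L (k + 1 - (k + 1)) (L * (j ν : ℕ) + (r ν : ℕ))) = fun ν => (r ν : ℕ) := by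
    funext ν; rw [Nat.sub_self, digit_zero_glue L _ _ (r ν).isLt]
  have hds : digit L (k + 1 - (k + 1)) (L * (t : ℕ) + (s : ℕ)) = (s : ℕ) := by rw [Nat.sub_self, digit_zero_glue L _ _ s.isLt]
  rw [stepT, hcoord, hdr, hds, lpt_succ_eq_cpt]
  rfl

/-- **THE COMPOSITION IDENTITY**: `Q_{k+1}(T_Bal(W)) = Q_k(T_Bal(W)) · Q₁(W_{k+1})` — the table averaging of Bałaban's composed table at level `k+1` IS the one at level `k` followed by the
one-step covariant averaging of the finest data field; with `TBal W 0 ≡ 1` (`TBal_zero`) this is [B9] (3.15)'s `Q_k(U) = Q(Ū^{(k−1)})⋯Q(Ū)Q(U)` for the data tower, as matrices.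
[cite: Balaban1985BackgroundPropagators, (3.14)–(3.15) p.393; Balaban1985Averaging, (125) p.36 (shape)] [folklore] -/
theorem QcovT_TBal_succ (W : (i : ℕ) → Fin d → (idx L M i → Matrix o o ℂ)) (k : ℕ) :
    QcovT (lev L (k + 1)) M (TBal L M W (k + 1)) = QcovT (lev L k) M (TBal L M W k) * Qstep (lev L k) L M (stepTable L M W k) := by
  haveI := lev_neZero L k
  exact QcovT_mul_Qstep (lev L k) L M _ _ _ fun y j r μ t s => TBal_glue_line L M W k y j r μ t s

omit hM in
/-- at level `0` the composed table is trivial: `TBal W 0 ≡ 1`, so `Q_0(T_Bal) = Q_0 ⊗ 1` (`QcovT_const_one`). [folklore] -/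
theorem TBal_zero (W : (i : ℕ) → Fin d → (idx L M i → Matrix o o ℂ)) : TBal L M W 0 = fun _ _ _ _ => 1 := by
  funext y j μ t; simp [TBal]

end Balaban

end Summit.QuantumFields.BalabanUV.T4Continuum.NE2.ComposedAveragingIdentity

end
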